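import Mathlib
import Summits.Ventures.PercRepro2.HCov
import Summits.Ventures.PercRepro2.RootLeafUSigns
import Summits.Ventures.PercRepro2.RootLeafUSecond
import Summits.Ventures.PercRepro2.RootLeafUOu
import Summits.Ventures.PercRepro2.RootLeafUHalf
import Summits.Ventures.PercRepro2.RootLeafUMixK
import Summits.Ventures.PercRepro2.RootLeafUMixL
import Summits.Ventures.PercRepro2.RootLeafUCoinGraph
import Summits.Ventures.PercRepro2.RootLeafUCoinShare
import Summits.Ventures.PercRepro2.RootLeafUCoinK

/-!
# (G4-u), the coin class: the `o ∈ L` half `T2oL ≥ 0` when `b` is adjacent exactly to `{a₂, u}`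
(blind cell PercRepro2, p4 g15; S3 (G4-u) item (ab); no definitions, every mass written out)

Conventions of RootLeafUMixL (`R = {u ↮ a₂, u ↮ c} = PD ⊔ T`, `W = D + t`, `Y = Y_N + Y_t` with
`Y_N = P(PD, oL)`, `Y_t = P(T, oL)`, `M = P(T, oL, bL)`, `B₁ = P(T, bL)`, `Y_bK`, `P(R, bK)`, `B = α − κ ≤ 0`,
`(OU) = T2oL(o := u) ≥ 0`, `δ_o = t·Y_N − D·Y_t ≥ 0`) and of RootLeafUCoinK (`N = 1 − p₁p₂`,
`ρ_K = p₁(1 − p₂)`, `ρ_L = (1 − p₁)p₂`, `Λ ≥ 0`).  On the coin class the shares give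

* `N·[(M·W − B₁·Y) − (Y_bK·W − P(R,bK)·Y)] = ρ_L·(Y_t·W − t·Y) = −ρ_L·δ_o` (the mixed term collapses, the
  `b ∈ K` slack vanishes);
* `N·(OU) + Γ·t = 2·W·Λ` with `Γ = N·|B| − 2β·ρ_L` (`N_OU_add_eq`) — the SAME payer `Λ` as on the `K` side;

so `N·(mirror expression) = Γ·δ_o + N·(OU)·Y`, which is `≥ 0` in both signs of `Γ`: for `Γ ≥ 0` termwise; for
`Γ < 0` by `0 ≤ δ_o ≤ t·Y_N ≤ t·Y`, `Γ·δ_o + N·(OU)·Y ≥ (Γ·t + N·(OU))·Y = 2·W·Λ·Y ≥ 0` — the o-free core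
`(OU)` is load-bearing exactly when the exact share `ρ_L/N` exceeds `|B|/(2β)`.  Hence (MIX-L) holds on the
class (`mixL_coin`) and **`0 ≤ T2oL`** (`T2oL_nonneg_coin`, through `MixL.T2oL_nonneg_of_mixL`).
-/

namespace Summit.Ventures.PercRepro2

open UnionCluster CovForm

namespace RootLeafU

namespace Coin

variable {V : Type*} {E : Type*} [Fintype E] [DecidableEq E] [Fintype V] [DecidableEq V]
  {R : Type*} [Field R] [LinearOrder R] [IsStrictOrderedRing R]

section LSide

variable (p : E → R) (ends : E → Sym2 V) (o a₂ c b u : V) {f₁ f₂ : E}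

omit [Fintype V] [DecidableEq V] [LinearOrder R] [IsStrictOrderedRing R] in
/-- **The mixed bracket collapses**: `N·[(M·W − B₁·Y) − (Y_bK·W − P(R,bK)·Y)] = ρ_L·(Y_t·W − t·Y)`. -/
theorem N_bracket_eq (hf₁ : ends f₁ = s(b, a₂)) (hf₂ : ends f₂ = s(b, u))
    (hb2 : ∀ e, b ∈ ends e → e = f₁ ∨ e = f₂) (hba : b ≠ a₂) (hbu : b ≠ u) (hne : f₁ ≠ f₂)
    (hbo : b ≠ o) (hbc : b ≠ c) :
    (1 - p f₁ * p f₂) * ((prob p (TEvent ends u a₂ c ∩ (connEvent ends u o ∩ connEvent ends u b)) * (prob p (PDEvent ends u a₂ c) + prob p (TEvent ends u a₂ c)) - prob p (TEvent ends u a₂ c ∩ connEvent ends u b) * (prob p (PDEvent ends u a₂ c ∩ connEvent ends u o) + prob p (TEvent ends u a₂ c ∩ connEvent ends u o))) - ((prob p (PDEvent ends u a₂ c ∩ (connEvent ends u o ∩ connEvent ends a₂ b)) + prob p (TEvent ends u a₂ c ∩ (connEvent ends u o ∩ connEvent ends a₂ b))) * (prob p (PDEvent ends u a₂ c) + prob p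 (TEvent ends u a₂ c)) - (prob p (PDEvent ends u a₂ c ∩ connEvent ends a₂ b) + prob p (TEvent ends u a₂ c ∩ connEvent ends a₂ b)) * (prob p (PDEvent ends u a₂ c ∩ connEvent ends u o) + prob p (TEvent ends u a₂ c ∩ connEvent ends u o)))) =
      (1 - p f₁) * p f₂ * (prob p (TEvent ends u a₂ c ∩ connEvent ends u o) * (prob p (PDEvent ends u a₂ c) + prob p (TEvent ends u a₂ c)) - prob p (TEvent ends u a₂ c) * (prob p (PDEvent ends u a₂ c ∩ connEvent ends u o) + prob p (TEvent ends u a₂ c ∩ connEvent ends u o))) := by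
  have sPD := stable_PD hf₁ hf₂ hb2 hba hbu hbc
  have sT := stable_T hf₁ hf₂ hb2 hba hbu hbc
  have soL := stable_connEvent hf₁ hf₂ hb2 hba hbu hbu.symm hbo.symm (x := u) (y := o)
  have hPD := fun ω hω => PD_notConn (c := c) (ends := ends) (u := u) (a₂ := a₂) Set.univ ω ⟨hω, trivial⟩
  have hT := fun ω hω => T_notConn (c := c) (ends := ends) (u := u) (a₂ := a₂) Set.univ ω ⟨hω, trivial⟩
  have l1 := prob_inter_bL p hf₁ hf₂ hb2 hba hbu hne (stable_inter sT soL) (T_notConn (connEvent ends u o))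
  have l2 := prob_inter_bL p hf₁ hf₂ hb2 hba hbu hne sT hT
  have l3 := prob_inter_bK p hf₁ hf₂ hb2 hba hbu hne (stable_inter sPD soL) (PD_notConn (connEvent ends u o))
  have l4 := prob_inter_bK p hf₁ hf₂ hb2 hba hbu hne (stable_inter sT soL) (T_notConn (connEvent ends u o))
  have l5 := prob_inter_bK p hf₁ hf₂ hb2 hba hbu hne sPD hPD
  have l6 := prob_inter_bK p hf₁ hf₂ hb2 hba hbu hne sT hT
  rw [Set.inter_assoc] at l1 l3 l4
  linear_combination (prob p (PDEvent ends u a₂ c) + prob p (TEvent ends u a₂ c)) * l1 - (prob p (PDEvent ends u a₂ c ∩ connEvent ends u o) + prob p (TEvent ends u a₂ c ∩ connEvent ends u o)) * l2 - (prob p (PDEvent ends u a₂ c) + prob p (TEvent ends u a₂ c)) * (l3 + l4) + (prob p (PDEvent ends u a₂ c ∩ connEvent ends u o) + prob p (TEvent ends u a₂ c ∩ connEvent ends u o)) * (l5 + l6)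

omit [Fintype V] in
/-- **The o-free core and the payer**: `N·(OU) + (−N·B − 2β·ρ_L)·t = 2·W·Λ`. -/
theorem N_OU_add_eq (hf₁ : ends f₁ = s(b, a₂)) (hf₂ : ends f₂ = s(b, u))
    (hb2 : ∀ e, b ∈ ends e → e = f₁ ∨ e = f₂) (hba : b ≠ a₂) (hbu : b ≠ u) (hne : f₁ ≠ f₂)
    (hbc : b ≠ c) :
    (1 - p f₁ * p f₂) * T2oL p ends u a₂ c b u +
      (-((1 - p f₁ * p f₂) * ((prob p (PDEvent ends u a₂ c) * prob p (connEvent ends a₂ b) + prob p (avoidAll ends a₂ {c}) * gap p ends u a₂ b) - (prob p Set.univ * EQb3 p ends u a₂ c b + prob p Set.univ * PDb p ends u a₂ c b + prob p (connEvent ends a₂ b) * EQ3 p ends u a₂ c + prob p (connEvent ends a₂ b) * prob p (avoidAll ends a₂ {u}) - (prob p Set.univ - prob p (avoidAll ends a₂ {c})) * gap p ends u a₂ b))) -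
        2 * (prob p Set.univ * prob p (PDEvent ends u a₂ c) + prob p (avoidAll ends a₂ {c}) * prob p (avoidAll ends a₂ {u})) * ((1 - p f₁) * p f₂)) * prob p (TEvent ends u a₂ c) =
      2 * (prob p (PDEvent ends u a₂ c) + prob p (TEvent ends u a₂ c)) * ((prob p (PDEvent ends u a₂ c) + prob p (TEvent ends a₂ u c)) * ((1 - p f₁ * p f₂) * prob p (connEvent ends a₂ b) - p f₁ * (1 - p f₂)) + (1 - p f₁) * p f₂ * ((prob p (PDEvent ends u a₂ c) + prob p (TEvent ends a₂ u c)) - prob p (avoidAll ends a₂ {c}) * prob p (avoidAll ends a₂ {u}))) := by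
  have sPD := stable_PD hf₁ hf₂ hb2 hba hbu hbc
  have sT := stable_T hf₁ hf₂ hb2 hba hbu hbc
  have hPD := fun ω hω => PD_notConn (c := c) (ends := ends) (u := u) (a₂ := a₂) Set.univ ω ⟨hω, trivial⟩
  have hT := fun ω hω => T_notConn (c := c) (ends := ends) (u := u) (a₂ := a₂) Set.univ ω ⟨hω, trivial⟩
  have l2 := prob_inter_bL p hf₁ hf₂ hb2 hba hbu hne sT hT
  have l5 := prob_inter_bK p hf₁ hf₂ hb2 hba hbu hne sPD hPD
  have l6 := prob_inter_bK p hf₁ hf₂ hb2 hba hbu hne sT hT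
  have hA := NA_sub_eq p ends a₂ c b u hf₁ hf₂ hb2 hba hbu hne hbc
  unfold T2oL
  simp only [connEvent_self, Set.inter_univ, Set.univ_inter]
  linear_combination (prob p (PDEvent ends u a₂ c) + prob p (TEvent ends u a₂ c)) * hA + 2 * (prob p Set.univ * prob p (PDEvent ends u a₂ c) + prob p (avoidAll ends a₂ {c}) * prob p (avoidAll ends a₂ {u})) * (l2 - l5 - l6)

omit [Fintype V] [DecidableEq V] [LinearOrder R] [IsStrictOrderedRing R] in
/-- At `p₁ = p₂ = 1` every `PD`/`T` mass vanishes (`Q` is null). -/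
lemma W_eq_zero_of_N (hf₁ : ends f₁ = s(b, a₂)) (hf₂ : ends f₂ = s(b, u))
    (hb2 : ∀ e, b ∈ ends e → e = f₁ ∨ e = f₂) (hba : b ≠ a₂) (hbu : b ≠ u) (hne : f₁ ≠ f₂) (hbc : b ≠ c)
    (hN : 1 - p f₁ * p f₂ = 0) :
    prob p (PDEvent ends u a₂ c) + prob p (TEvent ends u a₂ c) = 0 := by
  have hPD := fun ω hω => PD_notConn (c := c) (ends := ends) (u := u) (a₂ := a₂) Set.univ ω ⟨hω, trivial⟩
  have hT := fun ω hω => T_notConn (c := c) (ends := ends) (u := u) (a₂ := a₂) Set.univ ω ⟨hω, trivial⟩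
  rw [prob_eq_off_mul p hf₁ hf₂ hne (stable_PD hf₁ hf₂ hb2 hba hbu hbc) hPD,
    prob_eq_off_mul p hf₁ hf₂ hne (stable_T hf₁ hf₂ hb2 hba hbu hbc) hT, hN]
  ring

omit [Fintype E] [DecidableEq E] [Fintype V] [DecidableEq V] in
/-- **The two-sign argument** (pure algebra): if `N·Br = ρ_L·(Y_t·W − t·Y)` and
`N·OU + Γ·t = 2·W·Λ` with `Γ = −N·B − 2β·ρ_L`, `Λ ≥ 0`, `OU ≥ 0`, `0 ≤ δ_o = t·Y_N − D·Y_t` and all masses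
`≥ 0`, then `B·(Y_t·W − t·Y) + 2β·Br + OU·Y ≥ 0` (`N > 0`). -/
lemma Lside_alg {N Bc β ρL OU YN Yt D t Λ Br : R} (hN : 0 < N)
    (hBr : N * Br = ρL * (Yt * (D + t) - t * (YN + Yt)))
    (hOU : N * OU + (-(N * Bc) - 2 * β * ρL) * t = 2 * (D + t) * Λ)
    (hΛ : 0 ≤ Λ) (hOUnn : 0 ≤ OU) (hδ : Yt * D ≤ YN * t) (hD : 0 ≤ D) (ht : 0 ≤ t)
    (hYN : 0 ≤ YN) (hYt : 0 ≤ Yt) :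
    0 ≤ Bc * (Yt * (D + t) - t * (YN + Yt)) + 2 * β * Br + OU * (YN + Yt) := by
  -- `N·(goal) = Γ·δ_o + Ω·Y` with `Γ = −N·B − 2β·ρ_L`, `δ_o = t·Y_N − D·Y_t`, `Ω = N·OU`
  have key : N * (Bc * (Yt * (D + t) - t * (YN + Yt)) + 2 * β * Br + OU * (YN + Yt)) =
      (-(N * Bc) - 2 * β * ρL) * (t * YN - D * Yt) + (N * OU) * (YN + Yt) := by
    linear_combination 2 * β * hBr
  have hδ0 : 0 ≤ t * YN - D * Yt := by linarith
  have hδ1 : t * YN - D * Yt ≤ t * YN := by nlinarith [mul_nonneg hD hYt]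
  have hYY : t * YN ≤ t * (YN + Yt) := by nlinarith [mul_nonneg ht hYt]
  have hΩ : 0 ≤ N * OU := mul_nonneg hN.le hOUnn
  have h2WL : 0 ≤ 2 * (D + t) * Λ := mul_nonneg (by linarith) hΛ
  rw [← hOU] at h2WL
  have hR : 0 ≤ (-(N * Bc) - 2 * β * ρL) * (t * YN - D * Yt) + (N * OU) * (YN + Yt) := by
    rcases lt_or_ge (-(N * Bc) - 2 * β * ρL) 0 with hΓ | hΓ
    · have h1 := mul_le_mul_of_nonpos_left hδ1 hΓ.le
      have h2 := mul_le_mul_of_nonpos_left hYY hΓ.le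
      have h3 := mul_nonneg h2WL (add_nonneg hYN hYt)
      nlinarith [h1, h2, h3]
    · exact add_nonneg (mul_nonneg hΓ hδ0) (mul_nonneg hΩ (add_nonneg hYN hYt))
  rw [← key] at hR
  exact (mul_nonneg_iff_of_pos_left hN).1 hR

/-- **(MIX-L) on the coin class**: the hypothesis of `MixL.T2oL_nonneg_of_mixL`. -/
theorem mixL_coin (hp : IsProbVec p) (hf₁ : ends f₁ = s(b, a₂)) (hf₂ : ends f₂ = s(b, u))
    (hb2 : ∀ e, b ∈ ends e → e = f₁ ∨ e = f₂) (hba : b ≠ a₂) (hbu : b ≠ u) (hne : f₁ ≠ f₂)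
    (hbo : b ≠ o) (hbc : b ≠ c) :
    0 ≤ ((prob p (PDEvent ends u a₂ c) * prob p (connEvent ends a₂ b) + prob p (avoidAll ends a₂ {c}) * gap p ends u a₂ b) - (prob p Set.univ * EQb3 p ends u a₂ c b + prob p Set.univ * PDb p ends u a₂ c b + prob p (connEvent ends a₂ b) * EQ3 p ends u a₂ c + prob p (connEvent ends a₂ b) * prob p (avoidAll ends a₂ {u}) - (prob p Set.univ - prob p (avoidAll ends a₂ {c})) * gap p ends u a₂ b)) * (prob p (TEvent ends u a₂ c ∩ connEvent ends u o) * (prob p (PDEvent ends u a₂ c) + prob p (TEvent ends u a₂ c)) - prob p (TEvent ends u a₂ c) * (prob p (PDEvent ends u a₂ c ∩ connEvent ends u o) + prob p (TEvent ends u a₂ c ∩ connEvent ends u o))) +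
        2 * (prob p Set.univ * prob p (PDEvent ends u a₂ c) + prob p (avoidAll ends a₂ {c}) * prob p (avoidAll ends a₂ {u})) * ((prob p (TEvent ends u a₂ c ∩ (connEvent ends u o ∩ connEvent ends u b)) * (prob p (PDEvent ends u a₂ c) + prob p (TEvent ends u a₂ c)) - prob p (TEvent ends u a₂ c ∩ connEvent ends u b) * (prob p (PDEvent ends u a₂ c ∩ connEvent ends u o) + prob p (TEvent ends u a₂ c ∩ connEvent ends u o))) - ((prob p (PDEvent ends u a₂ c ∩ (connEvent ends u o ∩ connEvent ends a₂ b)) + prob p (TEvent ends u a₂ c ∩ (connEvent ends u o ∩ connEvent ends a₂ b))) * (prob p (PDEvent ends u a₂ c) + prob p (TEvent ends u a₂ c)) - (prob p (PDEvent ends u a₂ c ∩ connEvent ends a₂ b) + prob p (TEvent ends u a₂ c ∩ connEvent ends a₂ b)) * (prob p (PDEvent ends u a₂ c ∩ connEvent ends u o) + prob p (TEvent ends u a₂ c ∩ connEvent ends u o)))) +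
        T2oL p ends u a₂ c b u * (prob p (PDEvent ends u a₂ c ∩ connEvent ends u o) + prob p (TEvent ends u a₂ c ∩ connEvent ends u o)) := by
  have hBr := N_bracket_eq p ends o a₂ c b u hf₁ hf₂ hb2 hba hbu hne hbo hbc
  have hOU := N_OU_add_eq p ends a₂ c b u hf₁ hf₂ hb2 hba hbu hne hbc
  have hL := Lam_nonneg p ends a₂ c b u (f₁ := f₁) (f₂ := f₂) hp hf₁
  have hOUnn := T2oL_root_nonneg p ends a₂ c b u hp
  have hδ := ToL_mul_D_le p hp ends o u a₂ c
  have hN : 0 ≤ 1 - p f₁ * p f₂ := by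
    nlinarith [hp.nonneg f₁, hp.nonneg f₂, hp.le_one f₁, hp.le_one f₂]
  rcases hN.lt_or_eq with hpos | hzero
  · exact Lside_alg hpos hBr hOU hL hOUnn hδ (prob_nonneg hp _) (prob_nonneg hp _)
      (prob_nonneg hp _) (prob_nonneg hp _)
  · -- `N = 0`: every `PD`/`T` mass vanishes
    have h0 := W_eq_zero_of_N p ends a₂ c b u hf₁ hf₂ hb2 hba hbu hne hbc hzero.symm
    have hD := prob_nonneg hp (PDEvent ends u a₂ c)
    have ht := prob_nonneg hp (TEvent ends u a₂ c)
    have z : ∀ X : Set (Config E), prob p (PDEvent ends u a₂ c ∩ X) = 0 ∧ prob p (TEvent ends u a₂ c ∩ X) = 0 := by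
      intro X
      have hDX := prob_inter_le_left hp (PDEvent ends u a₂ c) X
      have hTX := prob_inter_le_left hp (TEvent ends u a₂ c) X
      have hDX0 := prob_nonneg hp (PDEvent ends u a₂ c ∩ X)
      have hTX0 := prob_nonneg hp (TEvent ends u a₂ c ∩ X)
      constructor <;> linarith
    have hD0 : prob p (PDEvent ends u a₂ c) = 0 := by linarith
    have ht0 : prob p (TEvent ends u a₂ c) = 0 := by linarith
    rw [(z (connEvent ends u o)).1, (z (connEvent ends u o)).2,
      (z (connEvent ends u o ∩ connEvent ends u b)).2, (z (connEvent ends u b)).2,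
      (z (connEvent ends u o ∩ connEvent ends a₂ b)).1, (z (connEvent ends u o ∩ connEvent ends a₂ b)).2,
      (z (connEvent ends a₂ b)).1, (z (connEvent ends a₂ b)).2, hD0, ht0]
    simp

/-- **`0 ≤ T2oL` on the coin class** «`b` adjacent exactly to `{a₂, u}`». -/
theorem T2oL_nonneg_coin (hp : IsProbVec p) (hf₁ : ends f₁ = s(b, a₂)) (hf₂ : ends f₂ = s(b, u))
    (hb2 : ∀ e, b ∈ ends e → e = f₁ ∨ e = f₂) (hba : b ≠ a₂) (hbu : b ≠ u) (hne : f₁ ≠ f₂)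
    (hbo : b ≠ o) (hbc : b ≠ c) : 0 ≤ T2oL p ends o a₂ c b u :=
  MixL.T2oL_nonneg_of_mixL p ends o a₂ c b u hp
    (mixL_coin p ends o a₂ c b u hp hf₁ hf₂ hb2 hba hbu hne hbo hbc)

end LSide

end Coin

end RootLeafU

end Summit.Ventures.PercRepro2
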